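import Mathlib
import Summits.CriticalPhenomena.PercolationContinuityZ3.Theorems.PercNearOneGluingNoHeavyLowerTailOrderedDifferencesQuadraticReduction
import Summits.CriticalPhenomena.PercolationContinuityZ3.Theorems.PercNearOneGluingNoHeavyLowerTailOrderedDifferencesQuadraticCertificates

/-!
# Tangential certificates for quadratic units at a ramified prime — the general descent, and `ζ₃`, `ζ₆`, `(5 ± √21)/2`

Helper file for crux `stmt-CriticalPhenomena-4575` (`NoHeavyLowerTail`, route `PercNearOneGluingNoHeavy`), new-inequality factory
seat `prim-ineq-gen-3` (gen 30).  Everything here is PROVED; no definitions.  Imports Mathlib and two sibling helper files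
(`…QuadraticReduction`: `quad_mul_expand`, `exists_int_add_int_mul_of_mem_adjoin_quad`; `…QuadraticCertificates`:
`int_indep_of_quad_no_int_root`).  Generalizes `…GoldenTangentFive` and `…TwoSqrt3TangentThree` (memo `CONJECTURE-J.md` §2).

SETTING.  `t² = u t + v` (`u v : ℤ`) in characteristic `0`; a prime `p` at which the class is RAMIFIED with the order `ℤ[t]` regular:
`θ : ℤ` a double root (`p ∣ θ² − uθ − v`, `p ∣ 2θ − u`) and a generator `π = α + β t` of the prime above `p`, witnessed by
`|N(π)| = |α² + uαβ − vβ²| = p` together with the two divisibilities that make `c ↦ c π̄ / N(π)` integral on `{a + bt : p ∣ a + θb}`: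
`p ∣ a + θ b ⟹ p ∣ aα + auβ − vbβ` and `p ∣ bα − aβ`.  Reducing a dependency with a coordinate outside `(π)` modulo `p = (π)²·unit`
sends `t ↦ θ + ε` in `𝔽_p[ε]/(ε²)` and produces a LEFT JORDAN CHAIN of length two at `θ`:
`v₀ (Z + θY) = 0`, `v₁ (Z + θY) + v₀ Y = 0`, `v₀ = a + θ b ≠ 0`, `v₁ = b`.

* `exists_tangent_chain_of_integral_dependency_quad` — ★★ the descent [while `p ∣ a_A + θ b_A` for all `A`, replace `c` by `c π̄ / N(π)`;
  the measure `∑ |a_A² + u a_A b_A − v b_A²|` (absolute norms) drops by the factor `p`; norms of non-zero elements are non-zero because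
  `1, t` are independent and `N(a + bt) = (a + bt)(a + bu − bt)` in `K`].
* `linearIndependent_pencil_quad_of_tangent_certificate` — ★★ 'no chain of length two at `θ` over a field of characteristic `p`'
  ⟹ the pencil rows at `t` are independent over every field of characteristic `0` in which `t² = ut + v` (and `X² = uX + v` has no
  integer root).
* Instances (ten-line numerics each): `…_cubeRootUnity_of_tangent_three` (`ζ₃`: `t² = −t − 1`, `p = 3`, `θ = 1`, `π = 1 + 2t = √−3`),
  `…_sixthRootUnity_of_tangent_three` (`ζ₆`: `t² = t − 1`, `θ = −1`, `π = 1 + t`); the class `(5 ± √21)/2` at `p = 3` (`θ = 1`) and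
  `p = 7` (`θ = −1`) is in the companion file `…QuadraticTangentSqrt21`.  So CONJECTURE J(3) at `θ = ±1` gives (C0) at `ζ₃`, `ζ₆`,
  `2 ± √3` (sibling file) and `(5 ± √21)/2`, and J(7) at `−1` gives `(5 ± √21)/2` again.
(prim-ineq-gen-3 gen 30, 2026-08-26.)
-/

namespace Summit.CriticalPhenomena.PercolationContinuityZ3.Theorems

namespace OrderedDifferences

open Finset
open scoped FinsetFamily

variable {α : Type*} [DecidableEq α]

/-- Norms of non-zero elements of `ℤ + ℤt` are non-zero: if `1, t` are independent over `ℤ` in a field `K` with `t² = ut + v`, then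
`a² + uab − vb² = 0` forces `a = b = 0` [`a² + uab − vb² = (a + bt)(a + bu − bt)` in `K`]. -/
theorem int_norm_quad_eq_zero {K : Type*} [Field K] {t : K} (u v : ℤ) (ht : t * t = (u : K) * t + (v : K))
    (hK : ∀ a b : ℤ, (a : K) + (b : K) * t = 0 → a = 0 ∧ b = 0) (a b : ℤ)
    (h : a * a + u * a * b - v * b * b = 0) : a = 0 ∧ b = 0 := by
  have e : ((a : K) + (b : K) * t) * (((a + b * u : ℤ) : K) + ((-b : ℤ) : K) * t) = 0 := by
    have : ((a * a + u * a * b - v * b * b : ℤ) : K) = 0 := by rw [h]; simp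
    push_cast at this ⊢
    linear_combination this - ((b : K) * b) * ht
  rcases mul_eq_zero.mp e with h1 | h1
  · exact hK a b h1
  · obtain ⟨h2, h3⟩ := hK _ _ h1
    have hb : b = 0 := by linarith
    subst hb
    constructor
    · simpa using h2
    · rfl

/-- **Integral dependency ⟹ Jordan chain of length two at the double root `θ` (quadratic units, ramified prime with principal prime
ideal `(α + βt)`).**  See the module doc-string for the hypotheses. -/
theorem exists_tangent_chain_of_integral_dependency_quad (𝒜 : Finset (Finset α)) (u v θ α' β' N : ℤ) (p : ℕ)
    (hroot : (p : ℤ) ∣ θ * θ - u * θ - v) (hder : (p : ℤ) ∣ 2 * θ - u)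
    (hπ : α' * α' + u * α' * β' - v * β' * β' = N) (hN : N.natAbs = p) (hp : 1 < p)
    (hdiv1 : ∀ a b : ℤ, (p : ℤ) ∣ a + θ * b → (p : ℤ) ∣ a * α' + a * u * β' - v * b * β')
    (hdiv2 : ∀ a b : ℤ, (p : ℤ) ∣ a + θ * b → (p : ℤ) ∣ b * α' - a * β')
    {K : Type*} [Field K] {t : K} (ht : t * t = (u : K) * t + (v : K))
    (hK : ∀ a b : ℤ, (a : K) + (b : K) * t = 0 → a = 0 ∧ b = 0)
    {F : Type*} [Field F] [CharP F p]
    (a b : ↥𝒜 → ℤ) (hab : ∃ A, a A ≠ 0 ∨ b A ≠ 0)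
    (hdep : ∀ E ∈ 𝒜 \\ 𝒜, ∑ A : 𝒜, ((a A : K) + (b A : K) * t) *
        ((if E ⊆ (A : Finset α) then (1 : K) else 0) + t * (if Disjoint E (A : Finset α) then (1 : K) else 0)) = 0) :
    ∃ v₀ v₁ : ↥𝒜 → F, v₀ ≠ 0 ∧
      (∀ E ∈ 𝒜 \\ 𝒜, ∑ A : 𝒜, v₀ A *
        ((if E ⊆ (A : Finset α) then (1 : F) else 0) + (θ : F) * (if Disjoint E (A : Finset α) then (1 : F) else 0)) = 0) ∧
      (∀ E ∈ 𝒜 \\ 𝒜, ∑ A : 𝒜, (v₁ A *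
        ((if E ⊆ (A : Finset α) then (1 : F) else 0) + (θ : F) * (if Disjoint E (A : Finset α) then (1 : F) else 0)) +
          v₀ A * (if Disjoint E (A : Finset α) then (1 : F) else 0)) = 0) := by
  classical
  let zI : ↥𝒜 → Finset α → ℤ := fun A E => if E ⊆ (A : Finset α) then 1 else 0
  let yI : ↥𝒜 → Finset α → ℤ := fun A E => if Disjoint E (A : Finset α) then 1 else 0
  have hN0 : N ≠ 0 := by
    intro h0; rw [h0] at hN; simp at hN; omega
  -- the two integer identities per column: (I) ∑ (a z + v b y) = 0, (II) ∑ (a y + b z + u b y) = 0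
  have hPQ : ∀ E ∈ 𝒜 \\ 𝒜, (∑ A : 𝒜, (a A * zI A E + v * (b A * yI A E)) = 0) ∧
      (∑ A : 𝒜, (a A * yI A E + b A * zI A E + u * (b A * yI A E)) = 0) := by
    intro E hE
    have h := hdep E hE
    have e : ∑ A : 𝒜, ((a A : K) + (b A : K) * t) *
        ((if E ⊆ (A : Finset α) then (1 : K) else 0) + t * (if Disjoint E (A : Finset α) then (1 : K) else 0)) =
        ((∑ A : 𝒜, (a A * zI A E + v * (b A * yI A E)) : ℤ) : K) +
          ((∑ A : 𝒜, (a A * yI A E + b A * zI A E + u * (b A * yI A E)) : ℤ) : K) * t := by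
      push_cast [zI, yI]
      rw [sum_mul, ← sum_add_distrib]
      refine sum_congr rfl fun A _ => ?_
      rw [quad_mul_expand ht]
    rw [e] at h
    exact hK _ _ h
  -- descent on ∑ |a² + u a b − v b²|
  suffices H : ∀ (n : ℕ) (a b : ↥𝒜 → ℤ), ∑ A : 𝒜, (a A * a A + u * a A * b A - v * b A * b A).natAbs ≤ n →
      (∃ A, a A ≠ 0 ∨ b A ≠ 0) →
      (∀ E ∈ 𝒜 \\ 𝒜, (∑ A : 𝒜, (a A * zI A E + v * (b A * yI A E)) = 0) ∧
        (∑ A : 𝒜, (a A * yI A E + b A * zI A E + u * (b A * yI A E)) = 0)) →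
      ∃ v₀ v₁ : ↥𝒜 → F, v₀ ≠ 0 ∧
        (∀ E ∈ 𝒜 \\ 𝒜, ∑ A : 𝒜, v₀ A *
          ((if E ⊆ (A : Finset α) then (1 : F) else 0) + (θ : F) * (if Disjoint E (A : Finset α) then (1 : F) else 0)) = 0) ∧
        (∀ E ∈ 𝒜 \\ 𝒜, ∑ A : 𝒜, (v₁ A *
          ((if E ⊆ (A : Finset α) then (1 : F) else 0) + (θ : F) * (if Disjoint E (A : Finset α) then (1 : F) else 0)) +
            v₀ A * (if Disjoint E (A : Finset α) then (1 : F) else 0)) = 0) from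
    H _ a b le_rfl hab hPQ
  intro n
  induction n with
  | zero =>
    intro a b hle hab _
    exfalso
    obtain ⟨A, hA⟩ := hab
    have h1 : (a A * a A + u * a A * b A - v * b A * b A).natAbs ≤
        ∑ B : 𝒜, (a B * a B + u * a B * b B - v * b B * b B).natAbs :=
      single_le_sum (f := fun B : ↥𝒜 => (a B * a B + u * a B * b B - v * b B * b B).natAbs) (fun B _ => Nat.zero_le _) (mem_univ A)
    have h0 : a A * a A + u * a A * b A - v * b A * b A = 0 := Int.natAbs_eq_zero.mp (by omega)
    obtain ⟨ha, hb⟩ := int_norm_quad_eq_zero u v ht hK _ _ h0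
    rcases hA with h | h
    · exact h ha
    · exact h hb
  | succ n ih =>
    intro a b hle hab hz
    by_cases hndvd : ∃ A, ¬ ((p : ℤ) ∣ a A + θ * b A)
    · -- reduce: t ↦ θ + ε (mod ε²)
      obtain ⟨A0, hA0⟩ := hndvd
      refine ⟨fun A => ((a A + θ * b A : ℤ) : F), fun A => ((b A : ℤ) : F), ?_, ?_, ?_⟩
      · intro hw
        have h0 := congr_fun hw A0
        simp only [Pi.zero_apply] at h0
        exact hA0 ((CharP.intCast_eq_zero_iff F p _).mp h0)
      · intro E hE
        obtain ⟨h1, h2⟩ := hz E hE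
        obtain ⟨r, hr⟩ := hroot
        have hr' : ((θ * θ - u * θ - v : ℤ) : F) = 0 := by
          rw [hr]; push_cast; rw [CharP.cast_eq_zero F p]; ring
        have e : ∑ A : 𝒜, (((a A + θ * b A : ℤ)) : F) *
            ((if E ⊆ (A : Finset α) then (1 : F) else 0) + (θ : F) * (if Disjoint E (A : Finset α) then (1 : F) else 0)) =
            ((∑ A : 𝒜, (a A * zI A E + v * (b A * yI A E)) : ℤ) : F) +
              (θ : F) * ((∑ A : 𝒜, (a A * yI A E + b A * zI A E + u * (b A * yI A E)) : ℤ) : F) +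
              ((θ * θ - u * θ - v : ℤ) : F) * ∑ A : 𝒜, ((b A : ℤ) : F) * (if Disjoint E (A : Finset α) then (1 : F) else 0) := by
          push_cast [zI, yI]
          rw [mul_sum, mul_sum, ← sum_add_distrib, ← sum_add_distrib]
          refine sum_congr rfl fun A _ => ?_
          ring
        rw [e, h1, h2, hr']
        push_cast
        ring
      · intro E hE
        obtain ⟨_, h2⟩ := hz E hE
        obtain ⟨d, hd⟩ := hder
        have hd' : ((2 * θ - u : ℤ) : F) = 0 := by
          rw [hd]; push_cast; rw [CharP.cast_eq_zero F p]; ring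
        have e : ∑ A : 𝒜, (((b A : ℤ) : F) *
            ((if E ⊆ (A : Finset α) then (1 : F) else 0) + (θ : F) * (if Disjoint E (A : Finset α) then (1 : F) else 0)) +
              (((a A + θ * b A : ℤ)) : F) * (if Disjoint E (A : Finset α) then (1 : F) else 0)) =
            ((∑ A : 𝒜, (a A * yI A E + b A * zI A E + u * (b A * yI A E)) : ℤ) : F) +
              ((2 * θ - u : ℤ) : F) * ∑ A : 𝒜, ((b A : ℤ) : F) * (if Disjoint E (A : Finset α) then (1 : F) else 0) := by
          push_cast [zI, yI]
          rw [mul_sum, ← sum_add_distrib]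
          refine sum_congr rfl fun A _ => ?_
          ring
        rw [e, h2, hd']
        push_cast
        ring
    · -- all a_A + θ b_A divisible by p: replace c by c·π̄/N(π) and recurse
      push Not at hndvd
      have hNd : ∀ x : ℤ, (p : ℤ) ∣ x → N ∣ x := by
        intro x hx
        rw [← hN] at hx
        exact Int.natAbs_dvd.mp hx
      have hdv1 : ∀ A, N ∣ a A * α' + a A * u * β' - v * b A * β' := fun A => hNd _ (hdiv1 _ _ (hndvd A))
      have hdv2 : ∀ A, N ∣ b A * α' - a A * β' := fun A => hNd _ (hdiv2 _ _ (hndvd A))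
      let a' : ↥𝒜 → ℤ := fun A => (a A * α' + a A * u * β' - v * b A * β') / N
      let b' : ↥𝒜 → ℤ := fun A => (b A * α' - a A * β') / N
      have haN : ∀ A, N * a' A = a A * α' + a A * u * β' - v * b A * β' := fun A => Int.mul_ediv_cancel' (hdv1 A)
      have hbN : ∀ A, N * b' A = b A * α' - a A * β' := fun A => Int.mul_ediv_cancel' (hdv2 A)
      -- c = π c':  a = α a' + v β b',  b = β a' + α b' + u β b'
      have ha : ∀ A, a A = α' * a' A + v * β' * b' A := by
        intro A
        have e : N * (α' * a' A + v * β' * b' A) = N * a A := by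
          have := haN A; have := hbN A
          linear_combination α' * haN A + (v * β') * hbN A + (a A) * hπ
        exact (mul_left_cancel₀ hN0 e).symm
      have hb : ∀ A, b A = β' * a' A + α' * b' A + u * β' * b' A := by
        intro A
        have e : N * (β' * a' A + α' * b' A + u * β' * b' A) = N * b A := by
          linear_combination β' * haN A + (α' + u * β') * hbN A + (b A) * hπ
        exact (mul_left_cancel₀ hN0 e).symm
      obtain ⟨A0, hA0⟩ := hab
      have hA0' : a' A0 ≠ 0 ∨ b' A0 ≠ 0 := by
        by_contra h
        push Not at h
        have h1 := ha A0; have h2 := hb A0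
        rw [h.1, h.2] at h1 h2
        rcases hA0 with h' | h'
        · exact h' (by rw [h1]; ring)
        · exact h' (by rw [h2]; ring)
      have hab' : ∃ A, a' A ≠ 0 ∨ b' A ≠ 0 := ⟨A0, hA0'⟩
      -- the measure drops: Nf(c) = N · Nf(c')
      have hNf : ∀ A, a A * a A + u * a A * b A - v * b A * b A =
          N * (a' A * a' A + u * a' A * b' A - v * b' A * b' A) := by
        intro A; rw [ha A, hb A, ← hπ]; ring
      have habs : ∀ A, (a A * a A + u * a A * b A - v * b A * b A).natAbs =
          p * (a' A * a' A + u * a' A * b' A - v * b' A * b' A).natAbs := by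
        intro A; rw [hNf A, Int.natAbs_mul, hN]
      have hle' : ∑ A : 𝒜, (a' A * a' A + u * a' A * b' A - v * b' A * b' A).natAbs ≤ n := by
        have e : ∑ A : 𝒜, (a A * a A + u * a A * b A - v * b A * b A).natAbs =
            p * ∑ A : 𝒜, (a' A * a' A + u * a' A * b' A - v * b' A * b' A).natAbs := by
          rw [mul_sum]; exact sum_congr rfl fun A _ => habs A
        rw [e] at hle
        have hpos : 1 ≤ ∑ A : 𝒜, (a' A * a' A + u * a' A * b' A - v * b' A * b' A).natAbs := by
          have h1 : (a' A0 * a' A0 + u * a' A0 * b' A0 - v * b' A0 * b' A0).natAbs ≤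
              ∑ B : 𝒜, (a' B * a' B + u * a' B * b' B - v * b' B * b' B).natAbs :=
            single_le_sum (f := fun B : ↥𝒜 => (a' B * a' B + u * a' B * b' B - v * b' B * b' B).natAbs)
              (fun B _ => Nat.zero_le _) (mem_univ A0)
          have h2 : (a' A0 * a' A0 + u * a' A0 * b' A0 - v * b' A0 * b' A0).natAbs ≠ 0 := by
            intro h0
            obtain ⟨h1', h2'⟩ := int_norm_quad_eq_zero u v ht hK _ _ (Int.natAbs_eq_zero.mp h0)
            rcases hA0' with h | h
            · exact h h1'
            · exact h h2'
          omega
        nlinarith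
      -- the integer identities persist (they hold for every scalar multiple of a dependency): N·(I') and N·(II') are ℤ-combinations of (I), (II)
      have hz' : ∀ E ∈ 𝒜 \\ 𝒜, (∑ A : 𝒜, (a' A * zI A E + v * (b' A * yI A E)) = 0) ∧
          (∑ A : 𝒜, (a' A * yI A E + b' A * zI A E + u * (b' A * yI A E)) = 0) := by
        intro E hE
        obtain ⟨h1, h2⟩ := hz E hE
        -- N·(I') = (α + uβ)(I) − vβ(II),   N·(II') = −β(I) + α(II)
        have e1 : N * ∑ A : 𝒜, (a' A * zI A E + v * (b' A * yI A E)) =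
            (α' + u * β') * ∑ A : 𝒜, (a A * zI A E + v * (b A * yI A E)) -
              v * β' * ∑ A : 𝒜, (a A * yI A E + b A * zI A E + u * (b A * yI A E)) := by
          rw [mul_sum, mul_sum, mul_sum, ← sum_sub_distrib]
          refine sum_congr rfl fun A _ => ?_
          have := haN A; have := hbN A
          linear_combination (zI A E) * haN A + (v * yI A E) * hbN A
        have e2 : N * ∑ A : 𝒜, (a' A * yI A E + b' A * zI A E + u * (b' A * yI A E)) =
            -β' * ∑ A : 𝒜, (a A * zI A E + v * (b A * yI A E)) +
              α' * ∑ A : 𝒜, (a A * yI A E + b A * zI A E + u * (b A * yI A E)) := by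
          rw [mul_sum, mul_sum, mul_sum, ← sum_add_distrib]
          refine sum_congr rfl fun A _ => ?_
          linear_combination (yI A E) * haN A + (zI A E + u * yI A E) * hbN A
        rw [h1, h2] at e1 e2
        constructor
        · have : N * ∑ A : 𝒜, (a' A * zI A E + v * (b' A * yI A E)) = 0 := by rw [e1]; ring
          exact (mul_eq_zero.mp this).resolve_left hN0
        · have : N * ∑ A : 𝒜, (a' A * yI A E + b' A * zI A E + u * (b' A * yI A E)) = 0 := by rw [e2]; ring
          exact (mul_eq_zero.mp this).resolve_left hN0
      exact ih a' b' hle' hab' hz'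

/-- **The tangential certificate for a quadratic unit class at a ramified prime.**  Under the numerical hypotheses of
`exists_tangent_chain_of_integral_dependency_quad` (`θ` a double root of `X² − uX − v` modulo `p`, `π = α + βt` with `|N(π)| = p`
generating the prime above `p`), if over a field `F` of characteristic `p` the pencil of `𝒜` has no left Jordan chain of length two at
`θ`, then the pencil rows of `𝒜` are linearly independent at every `t` with `t² = ut + v` over every field of characteristic `0`
(`X² = uX + v` without integer roots). -/
theorem linearIndependent_pencil_quad_of_tangent_certificate (𝒜 : Finset (Finset α)) (u v θ α' β' N : ℤ) (p : ℕ)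
    (hroot : (p : ℤ) ∣ θ * θ - u * θ - v) (hder : (p : ℤ) ∣ 2 * θ - u)
    (hπ : α' * α' + u * α' * β' - v * β' * β' = N) (hN : N.natAbs = p) (hp : 1 < p)
    (hdiv1 : ∀ a b : ℤ, (p : ℤ) ∣ a + θ * b → (p : ℤ) ∣ a * α' + a * u * β' - v * b * β')
    (hdiv2 : ∀ a b : ℤ, (p : ℤ) ∣ a + θ * b → (p : ℤ) ∣ b * α' - a * β')
    (hno : ∀ n : ℤ, n * n ≠ u * n + v)
    {F : Type*} [Field F] [CharP F p]
    (hF : ∀ v₀ v₁ : ↥𝒜 → F,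
      (∀ E ∈ 𝒜 \\ 𝒜, ∑ A : 𝒜, v₀ A *
        ((if E ⊆ (A : Finset α) then (1 : F) else 0) + (θ : F) * (if Disjoint E (A : Finset α) then (1 : F) else 0)) = 0) →
      (∀ E ∈ 𝒜 \\ 𝒜, ∑ A : 𝒜, (v₁ A *
        ((if E ⊆ (A : Finset α) then (1 : F) else 0) + (θ : F) * (if Disjoint E (A : Finset α) then (1 : F) else 0)) +
          v₀ A * (if Disjoint E (A : Finset α) then (1 : F) else 0)) = 0) →
      v₀ = 0)
    {K : Type*} [Field K] [CharZero K] {t : K} (ht : t * t = (u : K) * t + (v : K)) :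
    LinearIndependent K (fun A : 𝒜 => fun E : (𝒜 \\ 𝒜 : Finset (Finset α)) =>
      (if (E : Finset α) ⊆ (A : Finset α) then (1 : K) else 0) +
        t * (if Disjoint (E : Finset α) (A : Finset α) then (1 : K) else 0)) := by
  classical
  set R : Subalgebra ℤ K := Algebra.adjoin ℤ ({t} : Set K) with hR
  have htR : t ∈ R := Algebra.subset_adjoin (Set.mem_singleton t)
  let vR : ↥𝒜 → (𝒜 \\ 𝒜 : Finset (Finset α)) → R := fun A E =>
    ⟨(if (E : Finset α) ⊆ (A : Finset α) then (1 : K) else 0) +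
        t * (if Disjoint (E : Finset α) (A : Finset α) then (1 : K) else 0),
      R.add_mem (by split_ifs <;> simp [R.one_mem, R.zero_mem]) (R.mul_mem htR (by split_ifs <;> simp [R.one_mem, R.zero_mem]))⟩
  have hv : (fun A : ↥𝒜 => algebraMap R K ∘ vR A) = (fun A : 𝒜 => fun E : (𝒜 \\ 𝒜 : Finset (Finset α)) =>
      (if (E : Finset α) ⊆ (A : Finset α) then (1 : K) else 0) +
        t * (if Disjoint (E : Finset α) (A : Finset α) then (1 : K) else 0)) := by
    funext A E
    rfl
  rw [← hv, linearIndependent_algebraMap_comp_iff]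
  by_contra hdepR
  obtain ⟨g, hg, A0, hA0⟩ := Fintype.not_linearIndependent_iff.mp hdepR
  have hcoef : ∀ A : ↥𝒜, ∃ ab : ℤ × ℤ, ((g A : R) : K) = (ab.1 : K) + (ab.2 : K) * t := by
    intro A
    obtain ⟨a, b, h⟩ := exists_int_add_int_mul_of_mem_adjoin_quad u v ht (g A).2
    exact ⟨(a, b), h⟩
  choose ab hab using hcoef
  have hK : ∀ a b : ℤ, (a : K) + (b : K) * t = 0 → a = 0 ∧ b = 0 :=
    fun a b h => int_indep_of_quad_no_int_root u v ht hno a b h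
  have hne : ∃ A, (ab A).1 ≠ 0 ∨ (ab A).2 ≠ 0 := by
    refine ⟨A0, ?_⟩
    by_contra h
    push Not at h
    apply hA0
    have e : ((g A0 : R) : K) = 0 := by rw [hab A0, h.1, h.2]; simp
    exact Subtype.ext e
  have hdep : ∀ E ∈ 𝒜 \\ 𝒜, ∑ A : 𝒜, (((ab A).1 : K) + ((ab A).2 : K) * t) *
      ((if E ⊆ (A : Finset α) then (1 : K) else 0) + t * (if Disjoint E (A : Finset α) then (1 : K) else 0)) = 0 := by
    intro E hE
    have h := congr_fun hg ⟨E, hE⟩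
    simp only [Finset.sum_apply, Pi.smul_apply, smul_eq_mul, Pi.zero_apply] at h
    have h' : (((∑ i : ↥𝒜, g i * vR i ⟨E, hE⟩ : R)) : K) = 0 := by rw [h]; rfl
    have e : ∑ A : 𝒜, (((ab A).1 : K) + ((ab A).2 : K) * t) *
        ((if E ⊆ (A : Finset α) then (1 : K) else 0) + t * (if Disjoint E (A : Finset α) then (1 : K) else 0)) =
        (((∑ i : ↥𝒜, g i * vR i ⟨E, hE⟩ : R)) : K) := by
      push_cast
      refine sum_congr rfl fun A _ => ?_
      rw [hab A]
    rw [e, h']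
  obtain ⟨v₀, v₁, hv0, h1, h2⟩ := exists_tangent_chain_of_integral_dependency_quad 𝒜 u v θ α' β' N p hroot hder hπ hN hp
    hdiv1 hdiv2 ht hK (F := F) (fun A => (ab A).1) (fun A => (ab A).2) hne hdep
  exact hv0 (hF v₀ v₁ h1 h2)

/-- **`ζ₃` at the ramified prime `3`** (`t² = −t − 1 ≡ (t − 1)²` mod 3, `θ = 1`, `π = 1 + 2t = √−3`, `N(π) = 3`): no left Jordan chain of
length two at `θ = 1` over a field of characteristic `3` ⟹ (C0) at the primitive cube roots of unity. -/
theorem linearIndependent_pencil_cubeRootUnity_of_tangent_three (𝒜 : Finset (Finset α))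
    {F : Type*} [Field F] [CharP F 3]
    (hF : ∀ v₀ v₁ : ↥𝒜 → F,
      (∀ E ∈ 𝒜 \\ 𝒜, ∑ A : 𝒜, v₀ A *
        ((if E ⊆ (A : Finset α) then (1 : F) else 0) + ((1 : ℤ) : F) * (if Disjoint E (A : Finset α) then (1 : F) else 0)) = 0) →
      (∀ E ∈ 𝒜 \\ 𝒜, ∑ A : 𝒜, (v₁ A *
        ((if E ⊆ (A : Finset α) then (1 : F) else 0) + ((1 : ℤ) : F) * (if Disjoint E (A : Finset α) then (1 : F) else 0)) +
          v₀ A * (if Disjoint E (A : Finset α) then (1 : F) else 0)) = 0) →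
      v₀ = 0)
    {K : Type*} [Field K] [CharZero K] {t : K} (ht : t * t = ((-1 : ℤ) : K) * t + ((-1 : ℤ) : K)) :
    LinearIndependent K (fun A : 𝒜 => fun E : (𝒜 \\ 𝒜 : Finset (Finset α)) =>
      (if (E : Finset α) ⊆ (A : Finset α) then (1 : K) else 0) +
        t * (if Disjoint (E : Finset α) (A : Finset α) then (1 : K) else 0)) := by
  refine linearIndependent_pencil_quad_of_tangent_certificate 𝒜 (-1) (-1) 1 1 2 3 3 (by norm_num) (by norm_num) (by norm_num)
    (by norm_num) (by norm_num) ?_ ?_ ?_ hF ht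
  · intro a b h; omega
  · intro a b h; omega
  · intro n h
    have : (2 * n + 1) * (2 * n + 1) = -3 := by linear_combination 4 * h
    nlinarith

/-- **`ζ₆` at the ramified prime `3`** (`t² = t − 1 ≡ (t + 1)²` mod 3, `θ = −1`, `π = 1 + t`, `N(π) = 3`): no left Jordan chain of length two
at `θ = −1` over characteristic `3` ⟹ (C0) at the primitive sixth roots of unity. -/
theorem linearIndependent_pencil_sixthRootUnity_of_tangent_three (𝒜 : Finset (Finset α))
    {F : Type*} [Field F] [CharP F 3]
    (hF : ∀ v₀ v₁ : ↥𝒜 → F,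
      (∀ E ∈ 𝒜 \\ 𝒜, ∑ A : 𝒜, v₀ A *
        ((if E ⊆ (A : Finset α) then (1 : F) else 0) + ((-1 : ℤ) : F) * (if Disjoint E (A : Finset α) then (1 : F) else 0)) = 0) →
      (∀ E ∈ 𝒜 \\ 𝒜, ∑ A : 𝒜, (v₁ A *
        ((if E ⊆ (A : Finset α) then (1 : F) else 0) + ((-1 : ℤ) : F) * (if Disjoint E (A : Finset α) then (1 : F) else 0)) +
          v₀ A * (if Disjoint E (A : Finset α) then (1 : F) else 0)) = 0) →
      v₀ = 0)
    {K : Type*} [Field K] [CharZero K] {t : K} (ht : t * t = ((1 : ℤ) : K) * t + ((-1 : ℤ) : K)) :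
    LinearIndependent K (fun A : 𝒜 => fun E : (𝒜 \\ 𝒜 : Finset (Finset α)) =>
      (if (E : Finset α) ⊆ (A : Finset α) then (1 : K) else 0) +
        t * (if Disjoint (E : Finset α) (A : Finset α) then (1 : K) else 0)) := by
  refine linearIndependent_pencil_quad_of_tangent_certificate 𝒜 1 (-1) (-1) 1 1 3 3 (by norm_num) (by norm_num) (by norm_num)
    (by norm_num) (by norm_num) ?_ ?_ ?_ hF ht
  · intro a b h; omega
  · intro a b h; omega
  · intro n h
    have : (2 * n - 1) * (2 * n - 1) = -3 := by linear_combination 4 * h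
    nlinarith

end OrderedDifferences

end Summit.CriticalPhenomena.PercolationContinuityZ3.Theorems
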